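import Mathlib
import Summits.KontsevichZagierPeriods.KontsevichZagierPeriods.Theorems.SoloInformedPreparedFibre
import Literature.ModelTheory.ExponentialFields.SemialgebraicPreparation
import HarnessLib

/-!
# Solo-informed (A390-ii): the integrability-relevant part of Lion–Rolin prepared data

File F4c of the KERNEL LEMMA I programme.  Of the Lion–Rolin prepared form
`f(x', y) = a(x') |y − θ(x')|^r v(φ(x', y))` (`IsLRPreparedOn`, [Kaiser2022, Def. 3.10]) only five
data matter for integrability: the rational exponent `r`, the unit bound `c > 1`, the
`ℚ`-semialgebraic coefficient `a` and centre `θ`, and the unit factor `V = v ∘ φ` with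
`c⁻¹ ≤ V ≤ c` on the band.  We bundle them (`SoloInformedLRData`), extract them from
`IsLRPreparedOn`, and derive the fibrewise consequences over a point `w` of the base of a band
`bandOver B ξ j` with vertical fibre `J(w) = soloInformedEIoo (bandLower ξ j w) (bandUpper ξ j w)`:
the centre avoids the fibre, the prepared identity and unit bounds hold along the fibre, and the
logarithm of a prepared function is controlled by
`|log f| ≤ |log a| + |r| |log |y − θ|| + log c`, whence the weight bound
`1 + Σᵢ |log ρᵢ| ≤ K(w) + Σᵢ |rᵢ| |log |y − θᵢ(w)||` for a prepared family.
-/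

open MeasureTheory Set Real
open scoped ENNReal
open Literature.ModelTheory.ExponentialFields Literature.NumberTheory.Transcendental

namespace Summit.KontsevichZagierPeriods.KontsevichZagierPeriods.Theorems

/-- **Integrability-relevant Lion–Rolin data** of `f` on the band `T` over the base `S`:
`f z = a (init z) · |z_last − θ (init z)|^r · V z` on `T` with `c⁻¹ ≤ V ≤ c`, `c > 1`,
`a, θ` `ℚ`-semialgebraic on `S`, and the centre `θ` off the band. -/
structure SoloInformedLRData {n : ℕ} (S : Set (Fin n → ℝ)) (T : Set (Fin (n + 1) → ℝ))
    (f : (Fin (n + 1) → ℝ) → ℝ) where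
  /-- the exponent of `|y − θ|` -/
  r : ℚ
  /-- the bound of the unit factor -/
  c : ℝ
  /-- the coefficient -/
  a : (Fin n → ℝ) → ℝ
  /-- the centre -/
  θ : (Fin n → ℝ) → ℝ
  /-- the unit factor `v ∘ φ` -/
  V : (Fin (n + 1) → ℝ) → ℝ
  /-- `c > 1` -/
  one_lt_c : 1 < c
  /-- `a` is `ℚ`-semialgebraic on the base -/
  a_sa : IsSemialgebraicFunOn ℚ S a
  /-- `θ` is `ℚ`-semialgebraic on the base -/
  θ_sa : IsSemialgebraicFunOn ℚ S θ
  /-- the centre avoids the band -/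
  last_ne_θ : ∀ z ∈ T, z (Fin.last n) ≠ θ (Fin.init z)
  /-- two-sided bound of the unit factor on the band -/
  V_bounds : ∀ z ∈ T, c⁻¹ ≤ V z ∧ V z ≤ c
  /-- the prepared identity on the band -/
  f_eq : ∀ z ∈ T, f z = a (Fin.init z) * |z (Fin.last n) - θ (Fin.init z)| ^ (r : ℝ) * V z

/-- Lion–Rolin prepared functions carry integrability data. [cite: Kaiser2022, Def. 3.10] -/
theorem soloInformed_lrData_nonempty {n : ℕ} {S : Set (Fin n → ℝ)} {T : Set (Fin (n + 1) → ℝ)}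
    {f : (Fin (n + 1) → ℝ) → ℝ} (h : IsLRPreparedOn S T f) :
    Nonempty (SoloInformedLRData S T f) := by
  obtain ⟨r, q, M, c, δ, a, θ, b, b₁, b₂, v, _hq, hc, _hδ, ha, hθ, _hb, _hb₁, _hb₂, hne, _hv, _han,
    hvc, hcube, hf⟩ := h
  exact ⟨⟨r, c, a, θ, fun z => v (lrUnitArgs q θ b b₁ b₂ z), hc, ha, hθ, hne,
    fun z hz => hvc _ (hcube z hz), hf⟩⟩

namespace SoloInformedLRData

variable {n l : ℕ} {B : Set (Fin n → ℝ)} {ξ : Fin l → (Fin n → ℝ) → ℝ} {j : Fin (l + 1)}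
  {f : (Fin (n + 1) → ℝ) → ℝ}

/-- `1 ≤ c`. -/
theorem one_le_c {S : Set (Fin n → ℝ)} {T : Set (Fin (n + 1) → ℝ)} (d : SoloInformedLRData S T f) :
    1 ≤ d.c := d.one_lt_c.le

/-- `0 ≤ log c`. -/
theorem log_c_nonneg {S : Set (Fin n → ℝ)} {T : Set (Fin (n + 1) → ℝ)}
    (d : SoloInformedLRData S T f) : 0 ≤ Real.log d.c := Real.log_nonneg d.one_le_c

/-- The centre avoids the vertical fibre of the band. -/
theorem θ_notMem (d : SoloInformedLRData B (bandOver B ξ j) f) {w : Fin n → ℝ} (hw : w ∈ B) :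
    d.θ w ∉ soloInformedEIoo (bandLower ξ j w) (bandUpper ξ j w) := by
  intro hmem
  have hz : (Fin.snoc w (d.θ w) : Fin (n + 1) → ℝ) ∈ bandOver B ξ j :=
    snoc_mem_bandOver_iff.mpr ⟨hw, (soloInformed_mem_EIoo.mp hmem).1, (soloInformed_mem_EIoo.mp hmem).2⟩
  have h := d.last_ne_θ _ hz
  simp only [Fin.snoc_last, Fin.init_snoc] at h
  exact h rfl

/-- The prepared identity along the vertical fibre over `w`. -/
theorem fibre_eq (d : SoloInformedLRData B (bandOver B ξ j) f) {w : Fin n → ℝ} (hw : w ∈ B) :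
    ∀ y ∈ soloInformedEIoo (bandLower ξ j w) (bandUpper ξ j w),
      f (Fin.snoc w y) = d.a w * |y - d.θ w| ^ (d.r : ℝ) * d.V (Fin.snoc w y) := by
  intro y hy
  have hz : (Fin.snoc w y : Fin (n + 1) → ℝ) ∈ bandOver B ξ j :=
    snoc_mem_bandOver_iff.mpr ⟨hw, (soloInformed_mem_EIoo.mp hy).1, (soloInformed_mem_EIoo.mp hy).2⟩
  have h := d.f_eq _ hz
  simp only [Fin.snoc_last, Fin.init_snoc] at h
  exact h

/-- The unit bounds along the vertical fibre over `w`. -/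
theorem fibre_V (d : SoloInformedLRData B (bandOver B ξ j) f) {w : Fin n → ℝ} (hw : w ∈ B) :
    ∀ y ∈ soloInformedEIoo (bandLower ξ j w) (bandUpper ξ j w),
      d.c⁻¹ ≤ d.V (Fin.snoc w y) ∧ d.V (Fin.snoc w y) ≤ d.c := fun _ hy =>
  d.V_bounds _ (snoc_mem_bandOver_iff.mpr
    ⟨hw, (soloInformed_mem_EIoo.mp hy).1, (soloInformed_mem_EIoo.mp hy).2⟩)

/-- Points of the fibre differ from the centre. -/
theorem sub_θ_ne_zero (d : SoloInformedLRData B (bandOver B ξ j) f) {w : Fin n → ℝ} (hw : w ∈ B)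
    {y : ℝ} (hy : y ∈ soloInformedEIoo (bandLower ξ j w) (bandUpper ξ j w)) : y - d.θ w ≠ 0 :=
  sub_ne_zero.mpr fun h => d.θ_notMem hw (h ▸ hy)

end SoloInformedLRData

/-! ### Logarithms of prepared functions -/

/-- **Logarithm of a prepared value**: if `ρ = a |t|^r V` with `c⁻¹ ≤ V ≤ c`, `1 ≤ c`, `t ≠ 0`,
then `|log ρ| ≤ |log a| + |r| |log |t|| + log c` (also when `a = 0`, where `log ρ = 0`). -/
theorem soloInformed_abs_log_prepared_le {ρ a t r V c : ℝ} (hc : 1 ≤ c) (hV : c⁻¹ ≤ V ∧ V ≤ c)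
    (ht : t ≠ 0) (hρ : ρ = a * |t| ^ r * V) :
    |Real.log ρ| ≤ |Real.log a| + |r| * |Real.log (|t|)| + Real.log c := by
  have hc0 : 0 < c := by linarith
  have hlogc : 0 ≤ Real.log c := Real.log_nonneg hc
  by_cases ha : a = 0
  · rw [hρ, ha]
    simp only [zero_mul, Real.log_zero, abs_zero, zero_add]
    positivity
  have htpos : 0 < |t| := abs_pos.mpr ht
  have htr : 0 < |t| ^ r := Real.rpow_pos_of_pos htpos r
  have hVpos : 0 < V := lt_of_lt_of_le (inv_pos.mpr hc0) hV.1
  have hlogV : |Real.log V| ≤ Real.log c := by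
    rw [abs_le]
    constructor
    · rw [← Real.log_inv]
      exact Real.log_le_log (inv_pos.mpr hc0) hV.1
    · exact Real.log_le_log hVpos hV.2
  rw [hρ, Real.log_mul (mul_ne_zero ha htr.ne') hVpos.ne', Real.log_mul ha htr.ne',
    Real.log_rpow htpos]
  calc |Real.log a + r * Real.log (|t|) + Real.log V|
      ≤ |Real.log a + r * Real.log (|t|)| + |Real.log V| := abs_add_le _ _
    _ ≤ |Real.log a| + |r * Real.log (|t|)| + |Real.log V| := by
        gcongr
        exact abs_add_le _ _
    _ = |Real.log a| + |r| * |Real.log (|t|)| + |Real.log V| := by rw [abs_mul]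
    _ ≤ |Real.log a| + |r| * |Real.log (|t|)| + Real.log c := by gcongr

/-- **Fibre weight bound**: along the vertical fibre over `w ∈ B`, a family `ρᵢ` prepared on the
band satisfies `1 + Σᵢ |log ρᵢ(w, y)| ≤ (1 + Σᵢ (|log aᵢ w| + log cᵢ)) + Σᵢ |rᵢ| |log |y − θᵢ w||`. -/
theorem soloInformed_fibre_weight_le {n l : ℕ} {B : Set (Fin n → ℝ)} {ξ : Fin l → (Fin n → ℝ) → ℝ}
    {j : Fin (l + 1)} {ι : Type} [Fintype ι] {ρ : ι → (Fin (n + 1) → ℝ) → ℝ}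
    (d : ∀ i, SoloInformedLRData B (bandOver B ξ j) (ρ i)) {w : Fin n → ℝ} (hw : w ∈ B) {y : ℝ}
    (hy : y ∈ soloInformedEIoo (bandLower ξ j w) (bandUpper ξ j w)) :
    1 + ∑ i, |Real.log (ρ i (Fin.snoc w y))| ≤
      (1 + ∑ i, (|Real.log ((d i).a w)| + Real.log (d i).c)) +
        ∑ i, |((d i).r : ℝ)| * |Real.log (|y - (d i).θ w|)| := by
  have h : ∀ i, |Real.log (ρ i (Fin.snoc w y))| ≤ |Real.log ((d i).a w)| +
      |((d i).r : ℝ)| * |Real.log (|y - (d i).θ w|)| + Real.log (d i).c := fun i =>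
    soloInformed_abs_log_prepared_le (d i).one_le_c ((d i).fibre_V hw y hy)
      ((d i).sub_θ_ne_zero hw hy) ((d i).fibre_eq hw y hy)
  calc 1 + ∑ i, |Real.log (ρ i (Fin.snoc w y))|
      ≤ 1 + ∑ i, (|Real.log ((d i).a w)| + |((d i).r : ℝ)| * |Real.log (|y - (d i).θ w|)| +
          Real.log (d i).c) := by
        gcongr with i
        exact h i
    _ = (1 + ∑ i, (|Real.log ((d i).a w)| + Real.log (d i).c)) +
        ∑ i, |((d i).r : ℝ)| * |Real.log (|y - (d i).θ w|)| := by
        simp only [Finset.sum_add_distrib]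
        ring

/-- The fibre weight constant `K(w) = 1 + Σᵢ (|log aᵢ w| + log cᵢ)` is at least `1`. -/
theorem soloInformed_fibre_K_ge_one {n l : ℕ} {B : Set (Fin n → ℝ)} {ξ : Fin l → (Fin n → ℝ) → ℝ}
    {j : Fin (l + 1)} {ι : Type} [Fintype ι] {ρ : ι → (Fin (n + 1) → ℝ) → ℝ}
    (d : ∀ i, SoloInformedLRData B (bandOver B ξ j) (ρ i)) (w : Fin n → ℝ) :
    1 ≤ 1 + ∑ i, (|Real.log ((d i).a w)| + Real.log (d i).c) :=
  le_add_of_nonneg_right (Finset.sum_nonneg fun i _ =>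
    add_nonneg (abs_nonneg _) (d i).log_c_nonneg)

/-- An empty vertical fibre: if `¬ l < u` then `soloInformedEIoo l u = ∅`. -/
theorem soloInformed_EIoo_eq_empty {l u : EReal} (h : ¬ l < u) : soloInformedEIoo l u = ∅ :=
  Set.eq_empty_of_forall_notMem fun _ hy =>
    h ((soloInformed_mem_EIoo.mp hy).1.trans (soloInformed_mem_EIoo.mp hy).2)

end Summit.KontsevichZagierPeriods.KontsevichZagierPeriods.Theorems
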